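import Literature.Algebra.EuclideanLattices.LatticeProblemsProofs
import Literature.Computability.Complexity.PromiseCookReductions
import Literature.Computability.MetaComplexity.FregeProofs
import Literature.Computability.Complexity.EncodingFrames
import Mathlib.Data.Num.Lemmas
import HarnessLib

/-!
# `GapCVP′_γ` (Micciancio–Regev 2007, Def. 5.21) and Lemma 5.22, instance-level and as a Cook reduction

Topic `Algebra/EuclideanLattices` (family `pqc`, trunk T-LATTICE). Namespaces `Literature.Lattice`
(the YES/NO sets, next to `GapCVP.yes/no` of `Problems.lean`) and `Literature.PQC` (Lemma 5.22, next
to the GMSS reduction `gapSVP_reduces_to_gapCVP` of `LatticeProblems.lean`).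

Second-level brick of the decomposition of the named fact
`Literature.Computability.Cryptography.MicciancioRegev2007_gapSVP_to_SIS'` (`Literature/Computability/Cryptography/SIS.lean`,
MR07 Thm. 5.23 with Lemma 5.22): the printed reduction is
GapSVP_γ →(Lemma 5.22, deterministic Cook reduction, dimension-preserving) GapCVP′_γ →(Thm. 5.23) SIS′.
This file vendors the intermediate problem and PROVES Lemma 5.22 — first its mathematical
content (the GMSS calls are YES/NO instances of `GapCVP′_γ` as needed), then the reduction itself
as a Cook reduction of promise problems in the sense of Goldreich 2006, Def. 3
(`PromiseProblem.CookReducible`, `PromiseCookReductions.lean`), written as an explicit oracle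
algorithm `gmssAlg` in the transcript model of `Oracle.lean`, up to the single machine-level
fact `gmssAlg_isPolyTime` (its step function is polynomial-time; TM2 level), to be discharged
by the sibling `GapCVPPrimeMachine.lean` (next item).

## Contents

* `Literature.Lattice.GapCVP'.yes γ`, `Literature.Lattice.GapCVP'.no γ` (MR07 Def. 5.21): YES instances
  `((B, t), d)` with `dist(t, L(B)) ≤ d` (the YES instances of `GapCVP_γ`); NO instances with
  `λ₁(L(B)) > γ(n) d` AND `dist(k t, L(B)) > γ(n) d` for every odd integer `k` (so in
  particular, `k = 1`, NO instances of `GapCVP_γ`: `GapCVP'.no_subset_gapCVP_no`).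
* PROVED `Literature.Algebra.EuclideanLattices.MicciancioRegev2007_lemma_5_22` (MR07 Lemma 5.22 = GMSS 1999 Thm. 1 with the
  MR07 observation): for `B` of positive dimension, `(B, d) ∈ GapSVP_γ.YES ↔ ∃ i,
  (B⁽ⁱ⁾, bᵢ, d) ∈ GapCVP′_γ.YES`, and `(B, d) ∈ GapSVP_γ.NO → ∀ i, (B⁽ⁱ⁾, bᵢ, d) ∈ GapCVP′_γ.NO`
  — "for any odd integer `k`, `dist(k bᵢ, L(Bᵢ)) = dist(bᵢ, L(Bᵢ))` because `2bᵢ ∈ L(Bᵢ)`.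
  Moreover, `λ₁(Bᵢ) ≥ λ₁(B) > γ d`" (MR07 p. 27); here directly: `k bᵢ - L(B⁽ⁱ⁾) ⊆ L(B) ∖ {0}`
  for odd `k` (`Literature.Algebra.EuclideanLattices.minNorm_le_dist_zsmul_vec_of_mem_doubleRowLattice`) and
  `L(B⁽ⁱ⁾) ⊆ L(B)` gives `λ₁(L(B⁽ⁱ⁾)) ≥ λ₁(L(B))` (`Literature.Algebra.EuclideanLattices.minNorm_le_minNorm_doubleRowLattice`).
  The YES direction and the GMSS machinery (`doubleRow`, `gmssInstance` of
  `LatticeProblems.lean`; `doubleRowLattice`, `gapSVP_reduces_to_gapCVP_holds` of its proof file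
  `LatticeProblemsProofs.lean`) are reused. Restricted and degenerate forms:
  `MicciancioRegev2007_lemma_5_22_restricted` (dimension set `T`), `mem_gapSVP_yes_of_n_eq_zero`,
  `not_mem_gapSVP_no_of_n_eq_zero`, `exists_mem_gapCVP'_yes_and_no_of_n_eq_zero` (dimension `0`).
* The reduction as an oracle algorithm: `scanStep` (disjunctive scan over a query list, with
  PROVED run/transcript lemmas `runAux_scan_of_forall_eq_false`, `runAux_scan_of_exists_eq_true`,
  `mem_of_mem_queriesAux_scan`), `gmssQueries`; the query-size bound
  `length_encode_gmssInstance_le` (`≤ 31|x| + 22`, from the concrete encodings of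
  `Encoding.lean`); the SYNTACTIC step function `GMSS.gcore` (total on all strings: iterated
  `boolUnpair`, saturating binary evaluation `GMSS.satVal`, re-emission of the parsed pieces with
  row `j` doubled, `GMSS.dblEnts`/`GMSS.rowEnts`) with PROVED `GMSS.query_encode` /
  `gmssAlg_step_encode` (on codes it is the scan over `gmssQueries`); `gmssAlg : OracleAlg Bool`;
  the fact `gmssAlg_isPolyTime` (to be discharged by the sibling `GapCVPPrimeMachine.lean`, next item); and PROVED
  `gapSVP_cookReducible_gapCVP' (h : gmssAlg_isPolyTime) γ T :
   (GapSVP_γ restricted to dimensions in T).CookReducible (GapCVP′_γ restricted to T)`.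

## Faithfulness notes

* MR07 Def. 5.21 verbatim (authors' full version, p. 27): "An input to GapCVP′_γ is a triple
  `(B, t, d)` where `B` is an `n`-dimensional lattice basis, `t` is a target vector, and `d` is
  a rational number. In YES inputs `dist(t, L(B)) ≤ d`. In NO inputs `λ₁(B) > γ(n) · d` and for
  any odd `k ∈ ℤ`, `dist(k t, L(B)) > γ(n) · d`." As for `GapSVP`/`GapCVP` in `Problems.lean`
  (Micciancio–Goldwasser conventions), instances carry an integer nonsingular basis (MR07 work
  with full-rank lattices, §2 p. 6), an integer target and a rational `d`, and both sets
  require `0 < d` (for `d ≤ 0` the printed YES set is `{t ∈ L(B)}` and the reduction of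
  Lemma 5.22 never produces such calls from `GapSVP` instances with `d > 0`).
* Lemma 5.22 verbatim (p. 27): "For any approximation factor `γ(n)`, there is a polynomial time
  reduction from GapSVP_γ to GapCVP′_γ." Its proof is the GMSS Cook reduction — calls
  `(Bᵢ, bᵢ, d)`, `i = 1..n`, output YES iff some call answers YES — plus the displayed
  observation. `gapSVP_cookReducible_gapCVP'` is this statement in Goldreich's Def. 3 rendering
  (correct against every oracle solving `GapCVP′_γ`, arbitrary answers off the promise),
  dimension-wise (the calls keep the dimension, `gmssInstance_n`), with "polynomial time" split
  into the proved round/query budget `31|x| + 22` and the named fact `gmssAlg_isPolyTime`. In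
  dimension `0` the algorithm makes no call and accepts: such inputs on the promise are YES
  instances unless `γ(0) < 0`, in which case `GapCVP′_γ` has meeting YES/NO sets in dimension
  `0` and no oracle solves it (`exists_mem_gapCVP'_yes_and_no_of_n_eq_zero`), so Def. 3 asks
  nothing. The consequence for promise-BPP (MR07's use of the lemma, p. 27) is drawn downstream
  (`Literature/Computability/Cryptography/GapSVPToSIS.lean`) from the generic closure fact
  `PromiseProblem.mem_PromiseBPP'_of_cookReducible` (Goldreich 2006, remark after Def. 3).

## References

* D. Micciancio, O. Regev, *Worst-case to average-case reductions based on Gaussian measures*,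
  SIAM J. Comput. 37 (2007) 267–302; authors' full version, Def. 5.21 and Lemma 5.22 (p. 27).
* O. Goldreich, D. Micciancio, S. Safra, J.-P. Seifert, *Approximating shortest lattice vectors
  is not harder than approximating closest lattice vectors*, IPL 71 (1999), Thm. 1 / §3.
* O. Goldreich, *On promise problems: a survey*, LNCS 3895 (2006), §1.2 Def. 3.
* D. Micciancio, S. Goldwasser, *Complexity of Lattice Problems*, Kluwer 2002, Ch. 1 §1.2–1.3.
-/

noncomputable section

open Computability Literature.Computability.Complexity Literature.Computability.MetaComplexity Metric

namespace Literature.Algebra.EuclideanLattices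

namespace GapCVP'

/-- YES instances of `GapCVP′_γ` (MR07 Def. 5.21): triples `((B, t), d)` with `B` nonsingular,
`d > 0` and `dist(t, L(B)) ≤ d` — the YES instances of `GapCVP_γ` (`GapCVP'.yes_eq_gapCVP_yes`).
The set does not depend on `γ`. [cite: MicciancioRegev2007, Def. 5.21 (authors' version p. 27)] -/
def yes (_γ : ℕ → ℝ) : Set GapCVPInstance :=
  {p | p.1.I.IsNonsingular ∧ 0 < p.2 ∧ infDist p.1.targetE p.1.I.lattice ≤ (p.2 : ℝ)}

/-- NO instances of `GapCVP′_γ` (MR07 Def. 5.21): triples `((B, t), d)` with `B` nonsingular,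
`d > 0`, `λ₁(L(B)) > γ(n) · d` and `dist(k t, L(B)) > γ(n) · d` for every odd integer `k`
("when the target is far from the lattice, also any odd multiple of the target is far and the
minimum distance of the lattice is large", MR07 p. 27). [cite: MicciancioRegev2007, Def. 5.21 (authors' version p. 27)] -/
def no (γ : ℕ → ℝ) : Set GapCVPInstance :=
  {p | p.1.I.IsNonsingular ∧ 0 < p.2 ∧ γ p.1.I.n * (p.2 : ℝ) < minNorm p.1.I.lattice ∧
    ∀ k : ℤ, Odd k → γ p.1.I.n * (p.2 : ℝ) < infDist (k • p.1.targetE) p.1.I.lattice}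

/-- The YES instances of `GapCVP′_γ` are those of `GapCVP_γ` (MR07, remark after Def. 5.21). [cite: MicciancioRegev2007, Def. 5.21] -/
theorem yes_eq_gapCVP_yes (γ : ℕ → ℝ) : GapCVP'.yes γ = GapCVP.yes γ := rfl

/-- The YES set of `GapCVP′_γ` does not depend on `γ`. [cite: MicciancioRegev2007, Def. 5.21] -/
theorem yes_eq_yes (γ γ' : ℕ → ℝ) : GapCVP'.yes γ = GapCVP'.yes γ' := rfl

/-- NO instances of `GapCVP′_γ` are NO instances of `GapCVP_γ` (take `k = 1`; MR07, remark after
Def. 5.21: GapCVP′ only strengthens the NO promise). [cite: MicciancioRegev2007, Def. 5.21] -/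
theorem no_subset_gapCVP_no (γ : ℕ → ℝ) : GapCVP'.no γ ⊆ GapCVP.no γ := by
  rintro p ⟨h1, h2, -, h4⟩
  exact ⟨h1, h2, by simpa using h4 1 odd_one⟩

/-- A larger gap is an easier promise: for `γ ≤ γ'` every NO instance of `GapCVP′_{γ'}` is a NO
instance of `GapCVP′_γ`. [cite: MicciancioRegev2007, Def. 5.21] -/
theorem no_subset_no_of_le {γ γ' : ℕ → ℝ} (h : γ ≤ γ') : GapCVP'.no γ' ⊆ GapCVP'.no γ := by
  rintro p ⟨h1, h2, h3, h4⟩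
  have hmono : γ p.1.I.n * (p.2 : ℝ) ≤ γ' p.1.I.n * (p.2 : ℝ) :=
    mul_le_mul_of_nonneg_right (h _) (by exact_mod_cast h2.le)
  exact ⟨h1, h2, hmono.trans_lt h3, fun k hk => hmono.trans_lt (h4 k hk)⟩

end GapCVP'

/-- For `γ ≥ 1` the YES and NO instances of `GapCVP′_γ` are disjoint (they are YES/NO
instances of `GapCVP_γ`). [cite: MicciancioRegev2007, Def. 5.21] -/
theorem gapCVP'_disjoint {γ : ℕ → ℝ} (hγ : ∀ n, 1 ≤ γ n) :
    Disjoint (GapCVP'.yes γ) (GapCVP'.no γ) :=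
  (gapCVP_disjoint hγ).mono_right (GapCVP'.no_subset_gapCVP_no γ)

end Literature.Algebra.EuclideanLattices

namespace Literature.Algebra.EuclideanLattices


/-! ### Micciancio–Regev Lemma 5.22: the GMSS instances are `GapCVP′` instances -/

/-- For nonsingular `B`, `u ∈ L(B⁽ⁱ⁾)` and an ODD integer `k`, the difference `k bᵢ - u` is a
nonzero vector of `L(B)` (its `i`-th coordinate `k - (even)` is odd), so
`‖k bᵢ - u‖ ≥ λ₁(L(B))` (MR07 proof of Lemma 5.22: "`dist(k bᵢ, L(Bᵢ)) = dist(bᵢ, L(Bᵢ))`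
because `2bᵢ ∈ L(Bᵢ)`"; the case `k = 1` is GMSS 1999 §3,
`minNorm_le_dist_vec_of_mem_doubleRowLattice`). [cite: MicciancioRegev2007, Lemma 5.22 (proof, authors' version p. 27)] -/
theorem minNorm_le_dist_zsmul_vec_of_mem_doubleRowLattice {I : LatticeInstance}
    (hI : I.IsNonsingular) (i : Fin I.n) {k : ℤ} (hk : Odd k) {u : EuclideanSpace ℝ (Fin I.n)}
    (hu : u ∈ doubleRowLattice I i) :
    k • I.vec i - u ∈ I.lattice ∧ k • I.vec i - u ≠ 0 ∧ minNorm I.lattice ≤ dist (k • I.vec i) u := by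
  obtain ⟨z, rfl, hz⟩ := (mem_doubleRowLattice_iff I i u).1 hu
  have hrepr : k • I.vec i - I.ofCoeffs z = I.ofCoeffs (k • Pi.single i 1 - z) := by
    rw [ofCoeffs_sub, ofCoeffs_zsmul, ofCoeffs_single]
  have hmem : k • I.vec i - I.ofCoeffs z ∈ I.lattice := hrepr ▸ I.ofCoeffs_mem_lattice _
  have hne : k • I.vec i - I.ofCoeffs z ≠ 0 := by
    rw [hrepr, Ne, ofCoeffs_eq_zero_iff hI]
    intro h
    have hi := congrFun h i
    simp only [Pi.sub_apply, Pi.smul_apply, Pi.single_eq_same, smul_eq_mul, mul_one,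
      Pi.zero_apply, sub_eq_zero] at hi
    exact (Int.not_even_iff_odd.2 hk) (hi ▸ hz)
  exact ⟨hmem, hne, dist_eq_norm (k • I.vec i) (I.ofCoeffs z) ▸ minNorm_le_norm_of_mem hmem hne⟩

/-- Hence `λ₁(L(B)) ≤ dist(k bᵢ, L(B⁽ⁱ⁾))` for nonsingular `B`, every `i` and every odd `k`
(MR07 proof of Lemma 5.22). [cite: MicciancioRegev2007, Lemma 5.22 (proof, authors' version p. 27)] -/
theorem minNorm_le_infDist_zsmul_vec_doubleRowLattice {I : LatticeInstance} (hI : I.IsNonsingular)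
    (i : Fin I.n) {k : ℤ} (hk : Odd k) :
    minNorm I.lattice ≤ infDist (k • I.vec i) (doubleRowLattice I i : Set _) := by
  by_contra h
  push Not at h
  obtain ⟨u, hu, hlt⟩ := (infDist_lt_iff ⟨0, (doubleRowLattice I i).zero_mem⟩).1 h
  exact (lt_irrefl _)
    (hlt.trans_le' (minNorm_le_dist_zsmul_vec_of_mem_doubleRowLattice hI i hk hu).2.2)

/-- `2bᵢ` is a nonzero vector of `L(B⁽ⁱ⁾)` when `B` is nonsingular (it is the `i`-th row of
`B⁽ⁱ⁾`). [cite: GoldreichMicciancioSafraSeifert1999, §3] -/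
theorem two_smul_vec_mem_doubleRowLattice {I : LatticeInstance} (hI : I.IsNonsingular)
    (i : Fin I.n) :
    (2 : ℤ) • I.vec i ∈ doubleRowLattice I i ∧ (2 : ℤ) • I.vec i ≠ 0 := by
  refine ⟨(mem_doubleRowLattice_iff I i _).2 ⟨(2 : ℤ) • Pi.single i 1, ?_, ?_⟩, ?_⟩
  · rw [ofCoeffs_zsmul, ofCoeffs_single]
  · simp
  · intro h
    have h' : (2 : ℝ) • I.vec i = 0 := by
      rw [← h, ← Int.cast_smul_eq_zsmul ℝ (2 : ℤ) (I.vec i), Int.cast_ofNat]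
    rcases smul_eq_zero.1 h' with h2 | hv
    · exact two_ne_zero h2
    · exact (LatticeInstance.linearIndependent_vec hI).ne_zero i hv

/-- `λ₁(L(B⁽ⁱ⁾)) ≥ λ₁(L(B))` for nonsingular `B`, as `L(B⁽ⁱ⁾) ⊆ L(B)` (MR07 proof of
Lemma 5.22: "Moreover, `λ₁(Bᵢ) ≥ λ₁(B) > γd`"). [cite: MicciancioRegev2007, Lemma 5.22 (proof, authors' version p. 27)] -/
theorem minNorm_le_minNorm_doubleRowLattice {I : LatticeInstance} (hI : I.IsNonsingular)
    (i : Fin I.n) : minNorm I.lattice ≤ minNorm (doubleRowLattice I i) := by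
  refine le_csInf ?_ ?_
  · obtain ⟨hmem, hne⟩ := two_smul_vec_mem_doubleRowLattice hI i
    exact ⟨_, ⟨_, ⟨hmem, hne⟩, rfl⟩⟩
  · rintro _ ⟨x, ⟨hx, hx0⟩, rfl⟩
    exact minNorm_le_norm_of_mem (doubleRowLattice_le I i hx) hx0

/-- Unfolding the `i`-th GMSS instance as a `GapCVP′_γ` YES instance, in the ambient space of
`L(B)`. [cite: MicciancioRegev2007, Def. 5.21] -/
theorem gmssInstance_mem_gapCVP'_yes_iff (γ : ℕ → ℝ) (I : LatticeInstance) (i : Fin I.n)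
    (d : ℚ) :
    (gmssInstance I i, d) ∈ GapCVP'.yes γ ↔ (doubleRow I i).IsNonsingular ∧ 0 < d ∧
      infDist (I.vec i) (doubleRowLattice I i : Set _) ≤ (d : ℝ) :=
  Iff.rfl

/-- Unfolding the `i`-th GMSS instance as a `GapCVP′_γ` NO instance, in the ambient space of
`L(B)`. [cite: MicciancioRegev2007, Def. 5.21] -/
theorem gmssInstance_mem_gapCVP'_no_iff (γ : ℕ → ℝ) (I : LatticeInstance) (i : Fin I.n)
    (d : ℚ) :
    (gmssInstance I i, d) ∈ GapCVP'.no γ ↔ (doubleRow I i).IsNonsingular ∧ 0 < d ∧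
      γ I.n * (d : ℝ) < minNorm (doubleRowLattice I i) ∧
      ∀ k : ℤ, Odd k → γ I.n * (d : ℝ) < infDist (k • I.vec i) (doubleRowLattice I i : Set _) :=
  Iff.rfl

/-- **Micciancio–Regev 2007, Lemma 5.22, NO direction**: if `(B, d)` is a NO instance of
`GapSVP_γ` then every GMSS instance `(B⁽ⁱ⁾, bᵢ, d)` is a NO instance of `GapCVP′_γ`. [cite: MicciancioRegev2007, Lemma 5.22 (authors' version p. 27)] -/
theorem gmssInstance_mem_gapCVP'_no {γ : ℕ → ℝ} {I : LatticeInstance} {d : ℚ}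
    (h : (I, d) ∈ GapSVP.no γ) (i : Fin I.n) : (gmssInstance I i, d) ∈ GapCVP'.no γ := by
  obtain ⟨hI, hd, hγ⟩ := h
  exact (gmssInstance_mem_gapCVP'_no_iff γ I i d).2 ⟨isNonsingular_doubleRow hI i, hd,
    hγ.trans_le (minNorm_le_minNorm_doubleRowLattice hI i),
    fun k hk => hγ.trans_le (minNorm_le_infDist_zsmul_vec_doubleRowLattice hI i hk)⟩

/-- **Micciancio–Regev 2007, Lemma 5.22** (mathematical form of the deterministic Cook reduction
`GapSVP_γ → GapCVP′_γ`, same dimension, same factor; GMSS 1999 Thm. 1 with the MR07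
observation): for `B` of positive dimension and every threshold `d`,
`(B, d) ∈ GapSVP_γ.YES ↔ ∃ i, (B⁽ⁱ⁾, bᵢ, d) ∈ GapCVP′_γ.YES`, and
`(B, d) ∈ GapSVP_γ.NO → ∀ i, (B⁽ⁱ⁾, bᵢ, d) ∈ GapCVP′_γ.NO`. Hence the reduction "call the
oracle on `(B⁽ⁱ⁾, bᵢ, d)` for `i = 1, …, n` and answer YES iff some call does" is correct given
any oracle that is correct on the promise of `GapCVP′_γ` (calls off the promise occur only on YES
inputs, where they cannot hurt). [cite: MicciancioRegev2007, Lemma 5.22 (authors' version p. 27)] -/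
theorem MicciancioRegev2007_lemma_5_22 (γ : ℕ → ℝ) (I : LatticeInstance) (hn : I.n ≠ 0) (d : ℚ) :
    ((I, d) ∈ GapSVP.yes γ ↔ ∃ i, (gmssInstance I i, d) ∈ GapCVP'.yes γ) ∧
      ((I, d) ∈ GapSVP.no γ → ∀ i, (gmssInstance I i, d) ∈ GapCVP'.no γ) :=
  ⟨(gapSVP_reduces_to_gapCVP_holds γ I hn d).1, fun h i => gmssInstance_mem_gapCVP'_no h i⟩


/-! ### Lemma 5.22 respecting a restriction of the dimension set; degenerate inputs -/

/-- The GMSS instances have the dimension of the input lattice (`B⁽ⁱ⁾.n = B.n`). [cite: GoldreichMicciancioSafraSeifert1999, §3] -/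
theorem gmssInstance_n (I : LatticeInstance) (i : Fin I.n) : (gmssInstance I i).I.n = I.n := rfl

/-- **MR07 Lemma 5.22 respecting a restriction of the dimension set** (the form needed for
dimension-wise statements): for `T ⊆ ℕ` and an input `(B, d)` of positive dimension, `(B, d)` is
a YES instance of `GapSVP_γ` of dimension in `T` iff some GMSS call `(B⁽ⁱ⁾, bᵢ, d)` is a YES
instance of `GapCVP′_γ` of dimension in `T`; and if `(B, d)` is a NO instance of dimension in `T`
then every call is a NO instance of `GapCVP′_γ` of dimension in `T`. [cite: MicciancioRegev2007, Lemma 5.22 (authors' version p. 27)] -/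
theorem MicciancioRegev2007_lemma_5_22_restricted (γ : ℕ → ℝ) (T : Set ℕ) (I : LatticeInstance)
    (hn : I.n ≠ 0) (d : ℚ) :
    ((I, d) ∈ {p : GapSVPInstance | p ∈ GapSVP.yes γ ∧ p.1.n ∈ T} ↔
        ∃ i, (gmssInstance I i, d) ∈ {p : GapCVPInstance | p ∈ GapCVP'.yes γ ∧ p.1.I.n ∈ T}) ∧
      ((I, d) ∈ {p : GapSVPInstance | p ∈ GapSVP.no γ ∧ p.1.n ∈ T} →
        ∀ i, (gmssInstance I i, d) ∈ {p : GapCVPInstance | p ∈ GapCVP'.no γ ∧ p.1.I.n ∈ T}) := by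
  obtain ⟨hyes, hno⟩ := MicciancioRegev2007_lemma_5_22 γ I hn d
  refine ⟨⟨fun ⟨h, hT⟩ => ?_, fun ⟨i, hi, hT⟩ => ⟨hyes.2 ⟨i, hi⟩, hT⟩⟩,
    fun ⟨h, hT⟩ i => ⟨hno h i, hT⟩⟩
  obtain ⟨i, hi⟩ := hyes.1 h
  exact ⟨i, hi, hT⟩

/-- A `0`-dimensional lattice instance is nonsingular (`det` of the empty matrix is `1`). [folklore] -/
theorem isNonsingular_of_n_eq_zero {I : LatticeInstance} (h0 : I.n = 0) : I.IsNonsingular := by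
  haveI : IsEmpty (Fin I.n) := by rw [h0]; infer_instance
  change I.basis.det ≠ 0
  rw [Matrix.det_isEmpty]
  exact one_ne_zero

/-- In dimension `0` the minimum distance takes its junk value `0` (there is no nonzero
vector). [folklore] -/
theorem minNorm_eq_zero_of_n_eq_zero {I : LatticeInstance} (h0 : I.n = 0) :
    minNorm I.lattice = 0 := by
  haveI : IsEmpty (Fin I.n) := by rw [h0]; infer_instance
  have hset : {x : EuclideanSpace ℝ (Fin I.n) | x ∈ I.lattice ∧ x ≠ 0} = ∅ := by
    ext x
    simp only [Set.mem_setOf_eq, Set.mem_empty_iff_false, iff_false, not_and, not_not]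
    intro _
    exact Subsingleton.elim _ _
  unfold minNorm
  rw [hset, Set.image_empty, Real.sInf_empty]

/-- Degenerate inputs of the GMSS reduction (no oracle call is made): a `0`-dimensional instance
`(B, d)` with `d > 0` is a YES instance of `GapSVP_γ`. [cite: MicciancioRegev2007, Lemma 5.22 (authors' version p. 27)] -/
theorem mem_gapSVP_yes_of_n_eq_zero (γ : ℕ → ℝ) {I : LatticeInstance} (h0 : I.n = 0) {d : ℚ}
    (hd : 0 < d) : (I, d) ∈ GapSVP.yes γ := by
  refine ⟨isNonsingular_of_n_eq_zero h0, hd, ?_⟩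
  change minNorm I.lattice ≤ (d : ℝ)
  rw [minNorm_eq_zero_of_n_eq_zero h0]
  exact_mod_cast hd.le

/-- Degenerate inputs of the GMSS reduction: for `γ(0) ≥ 0` no `0`-dimensional instance is a NO
instance of `GapSVP_γ`. [cite: MicciancioRegev2007, Lemma 5.22 (authors' version p. 27)] -/
theorem not_mem_gapSVP_no_of_n_eq_zero (γ : ℕ → ℝ) (hγ : 0 ≤ γ 0) {I : LatticeInstance}
    (h0 : I.n = 0) (d : ℚ) : (I, d) ∉ GapSVP.no γ := by
  rintro ⟨-, hd, hlt⟩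
  change γ I.n * (d : ℝ) < minNorm I.lattice at hlt
  rw [minNorm_eq_zero_of_n_eq_zero h0, h0] at hlt
  exact (lt_irrefl (0 : ℝ)) (hlt.trans_le' (mul_nonneg hγ (by exact_mod_cast hd.le)))

/-- Degenerate inputs, the remaining case `γ(0) < 0`: a `0`-dimensional NO instance `(B, d)` of
`GapSVP_γ` (which forces `γ(0) d < 0`) yields the `0`-dimensional instance `((B, 0), d)` lying in
BOTH the YES and the NO set of `GapCVP′_γ` (its target `0` is a lattice point, and
`γ(0) d < 0 = λ₁ ≤ dist`), so that in this case no procedure solves `GapCVP′_γ` in dimension `0`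
and reductions to it are vacuously correct there. [cite: MicciancioRegev2007, Def. 5.21 and Lemma 5.22 (authors' version p. 27)] -/
theorem exists_mem_gapCVP'_yes_and_no_of_n_eq_zero {γ : ℕ → ℝ} {I : LatticeInstance} (h0 : I.n = 0)
    {d : ℚ} (h : (I, d) ∈ GapSVP.no γ) :
    ((⟨I, 0⟩ : CVPInstance), d) ∈ GapCVP'.yes γ ∧ ((⟨I, 0⟩ : CVPInstance), d) ∈ GapCVP'.no γ := by
  obtain ⟨hI, hd, hlt⟩ := h
  have hlt' : γ I.n * (d : ℝ) < 0 := by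
    have := hlt
    change γ I.n * (d : ℝ) < minNorm I.lattice at this
    rwa [minNorm_eq_zero_of_n_eq_zero h0] at this
  have ht : (⟨I, 0⟩ : CVPInstance).targetE = 0 := by
    change intVecToEuclidean I.n 0 = 0
    haveI : IsEmpty (Fin I.n) := by rw [h0]; infer_instance
    exact Subsingleton.elim _ _
  refine ⟨⟨hI, hd, ?_⟩, ⟨hI, hd, ?_, fun k _ => ?_⟩⟩
  · change infDist (⟨I, 0⟩ : CVPInstance).targetE (I.lattice : Set _) ≤ (d : ℝ)
    rw [ht, infDist_zero_of_mem (show (0 : EuclideanSpace ℝ (Fin I.n)) ∈ (I.lattice : Set _) from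
      I.lattice.zero_mem)]
    exact_mod_cast hd.le
  · exact hlt
  · change γ I.n * (d : ℝ) < infDist (k • (⟨I, 0⟩ : CVPInstance).targetE) (I.lattice : Set _)
    exact hlt'.trans_le infDist_nonneg

/-! ## Lemma 5.22 as a Cook reduction of promise problems: `GapSVP_γ → GapCVP′_γ`

Micciancio–Regev 2007, Lemma 5.22 (authors' full version p. 27): "For any approximation factor
`γ(n)`, there is a polynomial time reduction from GapSVP_γ to GapCVP′_γ." — the deterministic
Cook reduction of Goldreich–Micciancio–Safra–Seifert 1999 (Thm. 1 / §3): on input `(B, d)` call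
the oracle on `(B⁽ⁱ⁾, bᵢ, d)` for `i = 1, …, n` and answer YES iff some call is answered YES.
Below the reduction is written down as an oracle algorithm `gmssAlg : OracleAlg Bool` in the
transcript model of `Oracle.lean` and PROVED to be a Cook reduction of promise problems in the
sense of Goldreich 2006, Def. 3 (`PromiseProblem.CookReducible`) — correct against EVERY oracle
solving `GapCVP′_γ` (arbitrary answers off the promise), dimension-wise, within `n + 1` rounds and
with queries of length `≤ 31 |x| + 22` — up to the machine-level NAMED FACT `gmssAlg_isPolyTime`.
The run of the algorithm is analysed for a general "disjunctive scan" step function (`scanStep`),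
and the query-length bound is computed from the concrete instance encodings of `Encoding.lean`.
-/

/-! ### The disjunctive scan over a list of queries -/

/-- The step function of a *disjunctive scan* over the queries `qs`: if some answer received so
far is `[true]` output `true`; otherwise ask the next query if there is one, else output `false`.
This is the decision rule of the GMSS reduction ("the reduction outputs YES if and only if any
of the calls is answered YES", MR07 p. 27), made lazy. [cite: MicciancioRegev2007, Lemma 5.22 (proof, authors' version p. 27)] -/
def scanStep (qs : List (List Bool)) (answers : List (List Bool)) : List Bool ⊕ Bool :=
  if [true] ∈ answers then Sum.inr true
  else if h : answers.length < qs.length then Sum.inl (qs[answers.length]'h)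
  else Sum.inr false

section Scan

variable {M : OracleAlg Bool} {O : Oracle} {x : List Bool} {qs : List (List Bool)}

/-- **NO behaviour of the scan.** If every query of the list is answered `[false]`, the scan
started on the transcript of the first `j` answers outputs `false` after exactly
`|qs| - j + 1` more rounds. [cite: MicciancioRegev2007, Lemma 5.22 (proof, authors' version p. 27)] -/
theorem runAux_scan_of_forall_eq_false (hM : ∀ as, M.step x as = scanStep qs as)
    (hO : ∀ q ∈ qs, O q = [false]) :
    ∀ d j, j + d = qs.length → M.runAux O x (d + 1) (List.replicate j [false]) = some false := by
  intro d
  induction d with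
  | zero =>
    intro j hj
    rw [OracleAlg.runAux_succ, hM, scanStep, if_neg (by simp), dif_neg (by simp; omega)]
  | succ d ih =>
    intro j hj
    have hjlt : (List.replicate j [false]).length < qs.length := by simp; omega
    rw [OracleAlg.runAux_succ, hM, scanStep, if_neg (by simp), dif_pos hjlt]
    simp only [List.length_replicate]
    rw [hO _ (List.getElem_mem _), show List.replicate j [false] ++ [[false]] =
      List.replicate (j + 1) [false] by simp [List.replicate_succ']]
    exact ih (j + 1) (by omega)

/-- **YES behaviour of the scan.** If some query `qs[i₀]` is answered `[true]`, then the scan,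
continued from any transcript `as` of answers to the first `|as|` queries, outputs `true` within
`|qs| - |as| + 1` more rounds (whatever the other answers are: either `[true]` shows up in the
transcript earlier, or the scan reaches query `i₀`). [cite: MicciancioRegev2007, Lemma 5.22 (proof, authors' version p. 27)] -/
theorem runAux_scan_of_exists_eq_true (hM : ∀ as, M.step x as = scanStep qs as)
    {i₀ : ℕ} (hi₀ : i₀ < qs.length) (hO : O (qs[i₀]'hi₀) = [true]) :
    ∀ (d : ℕ) (as : List (List Bool)) (hd : as.length + d = qs.length),
      (∀ (i : ℕ) (hi : i < as.length), as[i] = O (qs[i]'(by omega))) →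
      M.runAux O x (d + 1) as = some true := by
  intro d
  induction d with
  | zero =>
    intro as hd has
    rw [OracleAlg.runAux_succ, hM, scanStep]
    have hmem : [true] ∈ as := by
      rw [← hO, ← has i₀ (by omega)]
      exact List.getElem_mem _
    rw [if_pos hmem]
  | succ d ih =>
    intro as hd has
    rw [OracleAlg.runAux_succ, hM, scanStep]
    by_cases hmem : [true] ∈ as
    · rw [if_pos hmem]
    · have hjlt : as.length < qs.length := by omega
      rw [if_neg hmem, dif_pos hjlt]
      change M.runAux O x (d + 1) (as ++ [O (qs[as.length]'hjlt)]) = some true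
      refine ih _ (by simp; omega) fun i hi => ?_
      simp only [List.length_append, List.length_singleton] at hi
      by_cases hij : i < as.length
      · rw [List.getElem_append_left hij]
        exact has i hij
      · obtain rfl : i = as.length := by omega
        rw [List.getElem_append_right (le_refl _)]
        simp

/-- Every query asked by the scan is one of the listed queries. [cite: MicciancioRegev2007, Lemma 5.22 (proof, authors' version p. 27)] -/
theorem mem_of_mem_queriesAux_scan (hM : ∀ as, M.step x as = scanStep qs as) :
    ∀ k as, ∀ y ∈ M.queriesAux O x k as, y ∈ qs := by
  intro k
  induction k with
  | zero => intro as y hy; simp at hy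
  | succ k ih =>
    intro as y hy
    unfold OracleAlg.queriesAux at hy
    rw [hM, scanStep] at hy
    by_cases hmem : [true] ∈ as
    · rw [if_pos hmem] at hy
      simp at hy
    · rw [if_neg hmem] at hy
      by_cases hlt : as.length < qs.length
      · rw [dif_pos hlt] at hy
        simp only [List.mem_cons] at hy
        rcases hy with rfl | hy
        · exact List.getElem_mem _
        · exact ih _ y hy
      · rw [dif_neg hlt] at hy
        simp at hy

end Scan

/-! ### The GMSS oracle algorithm -/

/-- The GMSS queries of an input `(B, d)`: the codes of the `GapCVP′` instances `((B⁽ⁱ⁾, bᵢ), d)`,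
`i < n` (same dimension `n`). [cite: GoldreichMicciancioSafraSeifert1999, §3] -/
def gmssQueries (p : GapSVPInstance) : List (List Bool) :=
  List.ofFn fun i : Fin p.1.n => gapCVPInstanceEncoding.encode (gmssInstance p.1 i, p.2)

/-! ### Size of the queries -/

-- `length_encode_listBool` (length of a `listBool` code) is the generic lemma of `Literature.CplxCore`
-- (currently housed in `MetaComplexity/FregeProofs.lean`).

/-- Doubling a natural number lengthens Mathlib's binary code by at most one bit. [folklore] -/
theorem length_encodeNat_two_mul_le (m : ℕ) :
    (encodeNat (2 * m)).length ≤ (encodeNat m).length + 1 := by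
  change (encodeNum (Num.ofNat' (2 * m))).length ≤ (encodeNum (Num.ofNat' m)).length + 1
  rw [← Nat.bit_false_apply, Num.ofNat'_bit]
  cases Num.ofNat' m with
  | zero => simp [encodeNum, Num.bit0]
  | pos p => simp [encodeNum, Num.bit0, encodePosNum]

/-- Length of the code of an integer: sign bit (doubled) , separator, binary digits. [folklore] -/
theorem length_encodingIntBool_encode (z : ℤ) :
    (encodingIntBool.encode z).length = 4 + (encodeNat z.natAbs).length := by
  change (boolPair (encodingBoolBool.encode (decide (z < 0))) (encodeNat z.natAbs)).length = _
  rw [length_boolPair]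
  have : (encodingBoolBool.encode (decide (z < 0))).length = 1 := rfl
  omega

/-- Doubling an integer lengthens its code by at most one bit. [folklore] -/
theorem length_encodingIntBool_two_mul_le (z : ℤ) :
    (encodingIntBool.encode (2 * z)).length ≤ (encodingIntBool.encode z).length + 1 := by
  rw [length_encodingIntBool_encode, length_encodingIntBool_encode, Int.natAbs_mul]
  have := length_encodeNat_two_mul_le z.natAbs
  change 4 + (encodeNat (2 * z.natAbs)).length ≤ _
  omega

/-- The row-major vector of a matrix, as used by `encodingIntMatrixFin`. [folklore] -/
theorem encodingIntMatrixFin_encode (n : ℕ) (B : Matrix (Fin n) (Fin n) ℤ) :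
    (encodingIntMatrixFin n).encode B =
      encodingIntBool.listBool.encode (List.ofFn fun m : Fin (n * n) =>
        B (finProdFinEquiv.symm m).1 (finProdFinEquiv.symm m).2) := by
  rfl

/-- Length of the code of an `n × n` integer matrix. [folklore] -/
theorem length_encodingIntMatrixFin_encode (n : ℕ) (B : Matrix (Fin n) (Fin n) ℤ) :
    ((encodingIntMatrixFin n).encode B).length = 2 * (n * n) + 2 +
      ∑ m : Fin (n * n), (2 * (encodingIntBool.encode
        (B (finProdFinEquiv.symm m).1 (finProdFinEquiv.symm m).2)).length + 2) := by
  rw [encodingIntMatrixFin_encode, length_encode_listBool, List.length_ofFn, List.map_ofFn,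
    List.sum_ofFn]
  rfl

/-- Length of the code of an integer vector of dimension `n`. [folklore] -/
theorem length_encodingIntVecFin_encode (n : ℕ) (v : Fin n → ℤ) :
    ((encodingIntVecFin n).encode v).length = 2 * n + 2 +
      ∑ k : Fin n, (2 * (encodingIntBool.encode (v k)).length + 2) := by
  change (encodingIntBool.listBool.encode (List.ofFn v)).length = _
  rw [length_encode_listBool, List.length_ofFn, List.map_ofFn, List.sum_ofFn]
  rfl

/-- Unfolding the code of a `GapSVP` instance `(B, d)`. [folklore] -/
theorem gapSVPInstanceEncoding_encode (I : LatticeInstance) (d : ℚ) :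
    gapSVPInstanceEncoding.encode (I, d) =
      boolPair (boolPair (encodeNat I.n) ((encodingIntMatrixFin I.n).encode I.basis))
        (encodingRatBool.encode d) :=
  rfl

/-- Unfolding the code of the `i`-th GMSS query `((B⁽ⁱ⁾, bᵢ), d)`. [folklore] -/
theorem gapCVPInstanceEncoding_encode_gmssInstance (I : LatticeInstance) (i : Fin I.n) (d : ℚ) :
    gapCVPInstanceEncoding.encode (gmssInstance I i, d) =
      boolPair (boolPair (encodeNat I.n)
        (boolPair ((encodingIntMatrixFin I.n).encode (doubleRow I i).basis)
          ((encodingIntVecFin I.n).encode (I.basis i))))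
        (encodingRatBool.encode d) :=
  rfl

/-- The code of `B⁽ⁱ⁾` is at most `2n²` bits longer than the code of `B` (each of the `n` doubled
entries grows by at most one bit, framed twice). [folklore] -/
theorem length_encode_doubleRow_basis_le (I : LatticeInstance) (i : Fin I.n) :
    ((encodingIntMatrixFin I.n).encode (doubleRow I i).basis).length ≤
      ((encodingIntMatrixFin I.n).encode I.basis).length + 2 * (I.n * I.n) := by
  rw [length_encodingIntMatrixFin_encode, length_encodingIntMatrixFin_encode]
  have key : ∀ m : Fin (I.n * I.n),
      2 * (encodingIntBool.encode ((doubleRow I i).basis (finProdFinEquiv.symm m).1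
        (finProdFinEquiv.symm m).2)).length + 2 ≤
      (2 * (encodingIntBool.encode (I.basis (finProdFinEquiv.symm m).1
        (finProdFinEquiv.symm m).2)).length + 2) + 2 := by
    intro m
    change 2 * (encodingIntBool.encode (I.basis.updateRow i ((2 : ℤ) • I.basis i)
      (finProdFinEquiv.symm m).1 (finProdFinEquiv.symm m).2)).length + 2 ≤ _
    rw [Matrix.updateRow_apply]
    split_ifs with h
    · simp only [Pi.smul_apply, smul_eq_mul]
      have := length_encodingIntBool_two_mul_le (I.basis i (finProdFinEquiv.symm m).2)
      subst h
      omega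
    · omega
  calc 2 * (I.n * I.n) + 2 + ∑ m, (2 * (encodingIntBool.encode ((doubleRow I i).basis
          (finProdFinEquiv.symm m).1 (finProdFinEquiv.symm m).2)).length + 2)
      ≤ 2 * (I.n * I.n) + 2 + ∑ m : Fin (I.n * I.n), ((2 * (encodingIntBool.encode (I.basis
          (finProdFinEquiv.symm m).1 (finProdFinEquiv.symm m).2)).length + 2) + 2) :=
        Nat.add_le_add_left (Finset.sum_le_sum fun m _ => key m) _
    _ = _ := by rw [Finset.sum_add_distrib]; simp; ring

/-- The code of the row `bᵢ` is no longer than the code of `B`. [folklore] -/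
theorem length_encode_row_le (I : LatticeInstance) (i : Fin I.n) :
    ((encodingIntVecFin I.n).encode (I.basis i)).length ≤
      ((encodingIntMatrixFin I.n).encode I.basis).length := by
  rw [length_encodingIntVecFin_encode, length_encodingIntMatrixFin_encode]
  have hn : I.n ≤ I.n * I.n := Nat.le_mul_self I.n
  have hsum : ∑ k : Fin I.n, (2 * (encodingIntBool.encode (I.basis i k)).length + 2) ≤
      ∑ m : Fin (I.n * I.n), (2 * (encodingIntBool.encode
        (I.basis (finProdFinEquiv.symm m).1 (finProdFinEquiv.symm m).2)).length + 2) := by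
    set g : Fin (I.n * I.n) → ℕ := fun m => 2 * (encodingIntBool.encode
        (I.basis (finProdFinEquiv.symm m).1 (finProdFinEquiv.symm m).2)).length + 2 with hg
    have hinj : Function.Injective fun k : Fin I.n => finProdFinEquiv (i, k) := by
      intro a b hab
      have := finProdFinEquiv.injective hab
      simpa using this
    calc ∑ k : Fin I.n, (2 * (encodingIntBool.encode (I.basis i k)).length + 2)
        = ∑ k : Fin I.n, g (finProdFinEquiv (i, k)) := by
          refine Finset.sum_congr rfl fun k _ => ?_
          simp only [hg, Equiv.symm_apply_apply]
      _ = ∑ m ∈ Finset.univ.image (fun k : Fin I.n => finProdFinEquiv (i, k)), g m := by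
          rw [Finset.sum_image fun a _ b _ hab => hinj hab]
      _ ≤ ∑ m, g m := Finset.sum_le_sum_of_subset (Finset.subset_univ _)
  omega

/-- **Size of the GMSS queries.** The code of the `i`-th query `((B⁽ⁱ⁾, bᵢ), d)` has length at
most `31 |x| + 22`, `x` the code of the input `(B, d)`. [cite: GoldreichMicciancioSafraSeifert1999, §3 (polynomial time)] -/
theorem length_encode_gmssInstance_le (I : LatticeInstance) (i : Fin I.n) (d : ℚ) :
    (gapCVPInstanceEncoding.encode (gmssInstance I i, d)).length ≤
      31 * (gapSVPInstanceEncoding.encode (I, d)).length + 22 := by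
  rw [gapCVPInstanceEncoding_encode_gmssInstance, gapSVPInstanceEncoding_encode]
  simp only [length_boolPair]
  have h1 := length_encode_doubleRow_basis_le I i
  have h2 := length_encode_row_le I i
  have h3 : 2 * (I.n * I.n) ≤ ((encodingIntMatrixFin I.n).encode I.basis).length := by
    rw [length_encodingIntMatrixFin_encode]; omega
  nlinarith [h1, h2, h3, Nat.zero_le (encodeNat I.n).length,
    Nat.zero_le (encodingRatBool.encode d).length]

/-- Every GMSS query of `(B, d)` has length at most `31 |x| + 22`. [cite: GoldreichMicciancioSafraSeifert1999, §3 (polynomial time)] -/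
theorem length_le_of_mem_gmssQueries {I : LatticeInstance} {d : ℚ} {y : List Bool}
    (hy : y ∈ gmssQueries (I, d)) :
    y.length ≤ 31 * (gapSVPInstanceEncoding.encode (I, d)).length + 22 := by
  simp only [gmssQueries, List.mem_ofFn] at hy
  obtain ⟨i, rfl⟩ := hy
  exact length_encode_gmssInstance_le I i d

/-- The dimension is bounded by the input size: `n ≤ |x|`. [cite: MicciancioGoldwasser2002, Ch. 1 §1.3] -/
theorem n_le_length_encode_gapSVP (I : LatticeInstance) (d : ℚ) :
    I.n ≤ (gapSVPInstanceEncoding.encode (I, d)).length := by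
  have h := I.n_le_length_encode
  change I.n ≤ (latticeInstanceEncoding.encode I).length at h
  change I.n ≤ (boolPair (latticeInstanceEncoding.encode I) (encodingRatBool.encode d)).length
  rw [length_boolPair]
  omega

/-! ### The GMSS oracle algorithm, syntactically -/

/-! #### The syntactic step function

The step function of the GMSS reduction has to be computed by a machine on EVERY input string
`x` (not only on codes of `GapSVP` instances) paired with every transcript. To keep the machine
(`GapCVPPrimeMachine.lean`) and its specification in lockstep, the step function is defined
here *syntactically*: by iterated applications of the pair decoder `boolUnpair` to `x` and to
the code of the transcript, a saturating evaluation of the binary dimension header, and a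
re-emission of the parsed pieces — total on all strings, and equal to the GMSS rule
(`scanStep (gmssQueries p)`) on codes `x = encode p` (`gmssAlg_step_encode`). -/

namespace GMSS

/-- Saturating value of a little-endian bit string: `min (bitsToNat l) K`, computed by the
recursion the machine uses (most significant bit first, doubling capped at `K`). [folklore] -/
def satVal (K : ℕ) : List Bool → ℕ
  | [] => 0
  | b :: l => min (b.toNat + 2 * satVal K l) K

/-- `satVal K l = min (bitsToNat l) K`. [folklore] -/
theorem satVal_eq_min (K : ℕ) : ∀ l : List Bool, satVal K l = min (bitsToNat l) K
  | [] => by simp [satVal]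
  | b :: l => by
    rw [satVal, satVal_eq_min K l, bitsToNat_cons]
    rcases le_total (bitsToNat l) K with h | h
    · rw [min_eq_left h]
    · rw [min_eq_right h, min_eq_right (by omega : K ≤ b.toNat + 2 * K), min_eq_right (by omega)]

/-- The dimension read off an input string: the saturating value (cap `|x|`) of the first
component of the first component of `x`. On the code of a `GapSVP` instance `(B, d)` of
dimension `n` this is `n` (`dimOf_encode`). [folklore] -/
def dimOf (x : List Bool) : ℕ := satVal x.length (boolUnpair (boolUnpair x).1).1

/-- The number of answers recorded in a transcript code: the length of its unary header.
[folklore] -/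
def tlen (T : List Bool) : ℕ := (boolUnpair T).1.length

/-- Scan of the first `j` framed items of `w` for the answer `[true]`. [folklore] -/
def hasTrue : ℕ → List Bool → Bool
  | 0, _ => false
  | j + 1, w => decide ((boolUnpair w).1 = [true]) || hasTrue j (boolUnpair w).2

/-- Does the transcript code record the answer `[true]`? [folklore] -/
def thas (T : List Bool) : Bool := hasTrue (tlen T) (boolUnpair T).2

/-- Doubling a binary numeral (least significant bit first; `[]` is zero). [folklore] -/
def dblNat : List Bool → List Bool
  | [] => []
  | b :: l => false :: b :: l

/-- Doubling the code of an integer: keep the sign component, double the magnitude. [folklore] -/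
def dblInt (e : List Bool) : List Bool := boolPair (boolUnpair e).1 (dblNat (boolUnpair e).2)

/-- Re-emission of a framed list of entry codes with the first `c` entries doubled (the tail
after `c` entries is copied verbatim). [folklore] -/
def dblRun : ℕ → List Bool → List Bool
  | 0, w => w
  | c + 1, w => boolPair (dblInt (boolUnpair w).1) (dblRun c (boolUnpair w).2)

/-- Re-emission of a framed list of entry codes with the `c` entries after the first `s`
doubled. [folklore] -/
def dblEnts : ℕ → ℕ → List Bool → List Bool
  | 0, c, w => dblRun c w
  | s + 1, c, w => boolPair (boolUnpair w).1 (dblEnts s c (boolUnpair w).2)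

/-- The framed list of the first `c` entries of a framed list. [folklore] -/
def rowRun : ℕ → List Bool → List Bool
  | 0, _ => []
  | c + 1, w => boolPair (boolUnpair w).1 (rowRun c (boolUnpair w).2)

/-- The framed list of the `c` entries after the first `s` of a framed list. [folklore] -/
def rowEnts : ℕ → ℕ → List Bool → List Bool
  | 0, c, w => rowRun c w
  | s + 1, c, w => rowEnts s c (boolUnpair w).2

/-- The `j`-th GMSS query assembled from the parsed pieces of `x` in dimension `n`: with
`x = ⟨⟨nc, ⟨hm, ents⟩⟩, er⟩`, the string `⟨⟨nc, ⟨⟨hm, ents with row j doubled⟩, ⟨1ⁿ, row j⟩⟩⟩, er⟩`.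
[cite: GoldreichMicciancioSafraSeifert1999, §3] -/
def query (x : List Bool) (j n : ℕ) : List Bool :=
  boolPair
    (boolPair (boolUnpair (boolUnpair x).1).1
      (boolPair
        (boolPair (boolUnpair (boolUnpair (boolUnpair x).1).2).1
          (dblEnts (j * n) n (boolUnpair (boolUnpair (boolUnpair x).1).2).2))
        (boolPair (unaryEncodeNat n) (rowEnts (j * n) n (boolUnpair (boolUnpair (boolUnpair x).1).2).2))))
    (boolUnpair x).2

/-- **The syntactic GMSS step** on an input string `x` and a transcript code `T`: dimension `0`
accepts; a recorded answer `[true]` accepts; all `n` calls answered otherwise rejects; else ask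
the next query. [cite: MicciancioRegev2007, Lemma 5.22 (authors' version p. 27)] -/
def gcore (x T : List Bool) : List Bool ⊕ Bool :=
  if dimOf x = 0 then Sum.inr true
  else if thas T = true then Sum.inr true
  else if dimOf x ≤ tlen T then Sum.inr false
  else Sum.inl (query x (tlen T) (dimOf x))

/-! #### The syntactic step on codes -/

/-- The transcript code (flat-frames view of `EncodingFrames.lean`). [folklore] -/
theorem transcript_eq (as : List (List Bool)) :
    (encodingList Bool).listBool.encode as = boolPair (unaryEncodeNat as.length) (frames as) := by
  rw [listBool_encode_eq, ← boolPair_eq]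
  congr 2
  rw [List.map_congr_left (fun a _ => show (encodingList Bool).encode a = id a from rfl), List.map_id]

/-- On a transcript code, `tlen` is the number of answers. [folklore] -/
theorem tlen_transcript (as : List (List Bool)) : tlen ((encodingList Bool).listBool.encode as) = as.length := by
  rw [transcript_eq, tlen, boolUnpair_boolPair, Literature.Computability.MetaComplexity.length_unaryEncodeNat]

/-- The scan of a framed list finds `[true]` iff it is an item. [folklore] -/
theorem hasTrue_frames (as : List (List Bool)) : hasTrue as.length (frames as) = decide ([true] ∈ as) := by
  induction as with
  | nil => simp [hasTrue]
  | cons a as ih =>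
    rw [List.length_cons, hasTrue, boolUnpair_frames_cons, ih]
    by_cases h : a = [true]
    · subst h; simp
    · simp [h, Ne.symm h]

/-- On a transcript code, `thas` tests membership of the answer `[true]`. [folklore] -/
theorem thas_transcript (as : List (List Bool)) :
    thas ((encodingList Bool).listBool.encode as) = decide ([true] ∈ as) := by
  rw [thas, tlen_transcript, transcript_eq, boolUnpair_boolPair, hasTrue_frames]

/-- Doubling a positive natural number prepends a zero bit to its binary code. [folklore] -/
theorem encodeNat_two_mul {m : ℕ} (hm : m ≠ 0) : encodeNat (2 * m) = false :: encodeNat m := by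
  change encodeNum (Num.ofNat' (2 * m)) = false :: encodeNum (Num.ofNat' m)
  rw [← Nat.bit_false_apply, Num.ofNat'_bit]
  cases h : Num.ofNat' m with
  | zero =>
    exfalso
    apply hm
    have := congr_arg (fun q : Num => (q : ℕ)) h
    simpa [Num.ofNat'_eq, Num.to_of_nat] using this
  | pos p => simp [encodeNum, Num.bit0, encodePosNum]

-- Twin of `Literature.Computability.AlgebraicComplexity.TavRecode.encodeNat_eq_nil_iff` (AlgebraicComplexity/RealTauConjectureDefinable.lean),
-- whose import closure is not wanted here; the proper home of both is `BoolEncodings.lean` (librarian item).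
/-- Only `0` has the empty binary code. [folklore] -/
theorem encodeNat_eq_nil_iff (m : ℕ) : encodeNat m = [] ↔ m = 0 := by
  constructor
  · intro h
    have := bitsToNat_encodeNat m
    rw [h] at this
    simpa using this.symm
  · rintro rfl; rfl

/-- `dblNat` doubles binary numerals. [folklore] -/
theorem dblNat_encodeNat (m : ℕ) : dblNat (encodeNat m) = encodeNat (2 * m) := by
  by_cases hm : m = 0
  · subst hm; rfl
  · rw [encodeNat_two_mul hm]
    cases h : encodeNat m with
    | nil => exact absurd ((encodeNat_eq_nil_iff m).1 h) hm
    | cons b l => rfl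

/-- The code of an integer: sign bit paired with the binary magnitude. [folklore] -/
theorem encodingIntBool_encode (z : ℤ) :
    encodingIntBool.encode z = boolPair [decide (z < 0)] (encodeNat z.natAbs) := rfl

/-- `dblInt` doubles integer codes. [folklore] -/
theorem dblInt_encode (z : ℤ) : dblInt (encodingIntBool.encode z) = encodingIntBool.encode (2 * z) := by
  rw [encodingIntBool_encode, encodingIntBool_encode, dblInt, boolUnpair_boolPair, dblNat_encodeNat,
    Int.natAbs_mul]
  have h2 : (2 : ℤ).natAbs = 2 := rfl
  rw [h2]
  congr 2
  by_cases hz : z < 0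
  · simp [hz]; linarith
  · simp [hz]; linarith

/-- `dblRun` on a framed list doubles its first entries. [folklore] -/
theorem dblRun_frames (l₃ : List (List Bool)) : ∀ l₂ : List (List Bool),
    dblRun l₂.length (frames (l₂ ++ l₃)) = frames (l₂.map dblInt ++ l₃)
  | [] => rfl
  | b :: l₂ => by
    rw [List.length_cons, dblRun, List.cons_append, boolUnpair_frames_cons, dblRun_frames l₃ l₂, List.map_cons,
      List.cons_append, frames_cons_eq_boolPair]

/-- `dblEnts` on a framed list doubles the entries of the selected stretch. [folklore] -/
theorem dblEnts_frames (l₂ l₃ : List (List Bool)) : ∀ l₁ : List (List Bool),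
    dblEnts l₁.length l₂.length (frames (l₁ ++ l₂ ++ l₃)) = frames (l₁ ++ l₂.map dblInt ++ l₃)
  | [] => by simp only [List.length_nil, List.nil_append, dblEnts]; exact dblRun_frames l₃ l₂
  | a :: l₁ => by
    rw [List.length_cons, dblEnts, List.append_assoc, List.cons_append, boolUnpair_frames_cons,
      ← List.append_assoc, dblEnts_frames l₂ l₃ l₁]
    simp only [List.append_assoc, List.cons_append, frames_cons_eq_boolPair]

/-- `rowRun` on a framed list extracts its first entries. [folklore] -/
theorem rowRun_frames (l₃ : List (List Bool)) : ∀ l₂ : List (List Bool),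
    rowRun l₂.length (frames (l₂ ++ l₃)) = frames l₂
  | [] => rfl
  | b :: l₂ => by
    rw [List.length_cons, rowRun, List.cons_append, boolUnpair_frames_cons, rowRun_frames l₃ l₂,
      frames_cons_eq_boolPair]

/-- `rowEnts` on a framed list extracts the selected stretch. [folklore] -/
theorem rowEnts_frames (l₂ l₃ : List (List Bool)) : ∀ l₁ : List (List Bool),
    rowEnts l₁.length l₂.length (frames (l₁ ++ l₂ ++ l₃)) = frames l₂
  | [] => by simp only [List.length_nil, List.nil_append, rowEnts]; exact rowRun_frames l₃ l₂
  | a :: l₁ => by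
    rw [List.length_cons, rowEnts, List.append_assoc, List.cons_append, boolUnpair_frames_cons,
      ← List.append_assoc, rowEnts_frames l₂ l₃ l₁]

/-- The row-major list of entry codes of an `n × n` integer matrix. [folklore] -/
def rowMajor (n : ℕ) (B : Matrix (Fin n) (Fin n) ℤ) : List (List Bool) :=
  List.ofFn fun m : Fin (n * n) => encodingIntBool.encode (B m.divNat m.modNat)

/-- The code of an integer matrix, framed (`finVec_encode_eq` of `EncodingFrames.lean`;
`encodingIntMatrixFin n` is `encodingFinVec encodingIntBool (n·n)` along the row-major equivalence).
[folklore] -/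
theorem matrix_encode_eq (n : ℕ) (B : Matrix (Fin n) (Fin n) ℤ) :
    (encodingIntMatrixFin n).encode B = boolPair (unaryEncodeNat (n * n)) (frames (rowMajor n B)) := by
  rw [encodingIntMatrixFin_encode, listBool_encode_eq, ← boolPair_eq, List.length_ofFn, List.map_ofFn]
  rfl

/-- The row-major list has `n²` entries. [folklore] -/
theorem length_rowMajor (n : ℕ) (B : Matrix (Fin n) (Fin n) ℤ) : (rowMajor n B).length = n * n := by
  simp [rowMajor]

/-- Splitting the row-major list at row `j`: before, row `j`, after. [folklore] -/
theorem rowMajor_split (n : ℕ) (B : Matrix (Fin n) (Fin n) ℤ) (j : Fin n) :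
    rowMajor n B = (rowMajor n B).take (j * n) ++ ((rowMajor n B).drop (j * n)).take n ++
      (rowMajor n B).drop (j * n + n) := by
  conv_lhs => rw [← List.take_append_drop (j * n) (rowMajor n B)]
  rw [List.append_assoc]
  congr 1
  conv_lhs => rw [← List.take_append_drop n ((rowMajor n B).drop (j * n))]
  rw [List.drop_drop]

/-- Row `j` ends within the `n²` entries. [folklore] -/
theorem jn_add_n_le (n : ℕ) (j : Fin n) : (j : ℕ) * n + n ≤ n * n := by
  have : ((j : ℕ) + 1) * n ≤ n * n := Nat.mul_le_mul_right n j.isLt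
  rwa [Nat.succ_mul] at this

/-- Entries of the row-major list. [folklore] -/
theorem getElem_rowMajor (n : ℕ) (B : Matrix (Fin n) (Fin n) ℤ) {m : ℕ} (hm : m < (rowMajor n B).length) :
    (rowMajor n B)[m] = encodingIntBool.encode
      (B ⟨m / n, Nat.div_lt_of_lt_mul (by simpa [length_rowMajor, Nat.mul_comm] using hm)⟩
        ⟨m % n, Nat.mod_lt _ (Nat.pos_of_ne_zero fun h => by simp [length_rowMajor, h] at hm)⟩) := by
  simp [rowMajor, Fin.divNat, Fin.modNat]

/-- The middle piece is the code list of row `j`. [folklore] -/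
theorem rowMajor_row (n : ℕ) (B : Matrix (Fin n) (Fin n) ℤ) (j : Fin n) :
    ((rowMajor n B).drop (j * n)).take n = List.ofFn fun k : Fin n => encodingIntBool.encode (B j k) := by
  have hn : 0 < n := Fin.pos j
  have hle := jn_add_n_le n j
  apply List.ext_getElem
  · simp [length_rowMajor]; omega
  · intro k h₁ h₂
    simp only [List.length_ofFn] at h₂
    have hdiv : ((j : ℕ) * n + k) / n = j := by
      rw [Nat.add_comm, Nat.add_mul_div_right _ _ hn, Nat.div_eq_of_lt h₂, Nat.zero_add]
    have hmod : ((j : ℕ) * n + k) % n = k := by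
      rw [Nat.add_comm, Nat.add_mul_mod_self_right, Nat.mod_eq_of_lt h₂]
    rw [List.getElem_take, List.getElem_drop, List.getElem_ofFn, getElem_rowMajor]
    simp only [hdiv, hmod, Fin.eta]

/-- Entries of `B⁽ⁱ⁾`: row `i` doubled. [cite: GoldreichMicciancioSafraSeifert1999, §3] -/
theorem doubleRow_basis_apply (I : LatticeInstance) (i a b : Fin I.n) :
    (doubleRow I i).basis a b = if a = i then 2 * I.basis i b else I.basis a b := by
  change (I.basis.updateRow i ((2 : ℤ) • I.basis i)) a b = _
  rw [Matrix.updateRow_apply]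
  split_ifs with h
  · simp
  · rfl

/-- The row-major list of `B⁽ʲ⁾`: the same pieces with row `j` doubled. [folklore] -/
theorem rowMajor_doubleRow (I : LatticeInstance) (j : Fin I.n) :
    rowMajor I.n (doubleRow I j).basis =
      (rowMajor I.n I.basis).take (j * I.n) ++ (((rowMajor I.n I.basis).drop (j * I.n)).take I.n).map dblInt ++
        (rowMajor I.n I.basis).drop (j * I.n + I.n) := by
  have hn : 0 < I.n := Fin.pos j
  have hle := jn_add_n_le I.n j
  rw [rowMajor_split I.n (doubleRow I j).basis j]
  have hL : (rowMajor I.n (doubleRow I j).basis).length = I.n * I.n := length_rowMajor _ _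
  have hL' : (rowMajor I.n I.basis).length = I.n * I.n := length_rowMajor _ _
  congr 1
  congr 1
  · apply List.ext_getElem
    · simp [hL, hL']
    · intro m h₁ h₂
      have hm : m < j * I.n := by simp [hL] at h₁; omega
      have hlt : m / I.n < j := (Nat.div_lt_iff_lt_mul hn).2 hm
      rw [List.getElem_take, List.getElem_take, getElem_rowMajor, getElem_rowMajor, doubleRow_basis_apply,
        if_neg]
      intro h
      rw [Fin.ext_iff] at h
      simp only at h
      omega
  · apply List.ext_getElem
    · simp [hL, hL']
    · intro k h₁ h₂
      have hk : k < I.n := by simp [hL] at h₁; omega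
      have hdiv : ((j : ℕ) * I.n + k) / I.n = j := by
        rw [Nat.add_comm, Nat.add_mul_div_right _ _ hn, Nat.div_eq_of_lt hk, Nat.zero_add]
      have hmod : ((j : ℕ) * I.n + k) % I.n = k := by
        rw [Nat.add_comm, Nat.add_mul_mod_self_right, Nat.mod_eq_of_lt hk]
      rw [List.getElem_map, List.getElem_take, List.getElem_take, List.getElem_drop, List.getElem_drop,
        getElem_rowMajor, getElem_rowMajor]
      simp only [hdiv, hmod, Fin.eta, doubleRow_basis_apply, if_true, dblInt_encode]
  · apply List.ext_getElem
    · simp [hL, hL']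
    · intro m h₁ h₂
      have h4 : (j : ℕ) + 1 ≤ ((j : ℕ) * I.n + I.n + m) / I.n := by
        rw [Nat.le_div_iff_mul_le hn, Nat.succ_mul]
        omega
      rw [List.getElem_drop, List.getElem_drop, getElem_rowMajor, getElem_rowMajor, doubleRow_basis_apply,
        if_neg]
      intro h
      rw [Fin.ext_iff] at h
      simp only at h
      omega

/-- The code of a `GapSVP` instance, framed. [folklore] -/
theorem gapSVP_encode_eq (I : LatticeInstance) (d : ℚ) :
    gapSVPInstanceEncoding.encode (I, d) =
      boolPair (boolPair (encodeNat I.n) (boolPair (unaryEncodeNat (I.n * I.n)) (frames (rowMajor I.n I.basis))))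
        (encodingRatBool.encode d) := by
  rw [gapSVPInstanceEncoding_encode, matrix_encode_eq]

/-- On the code of `(B, d)` the dimension read off is `n`. [folklore] -/
theorem dimOf_encode (I : LatticeInstance) (d : ℚ) : dimOf (gapSVPInstanceEncoding.encode (I, d)) = I.n := by
  have hle := n_le_length_encode_gapSVP I d
  have h1 : (boolUnpair (boolUnpair (gapSVPInstanceEncoding.encode (I, d))).1).1 = encodeNat I.n := by
    rw [gapSVPInstanceEncoding_encode, boolUnpair_boolPair, boolUnpair_boolPair]
  rw [dimOf, h1, satVal_eq_min, bitsToNat_encodeNat, min_eq_left hle]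

/-- The code of an integer vector, framed (`finVec_encode_eq`: `encodingIntVecFin n` is
`encodingFinVec encodingIntBool n` by definition). [folklore] -/
theorem vec_encode_eq (n : ℕ) (v : Fin n → ℤ) :
    (encodingIntVecFin n).encode v = boolPair (unaryEncodeNat n) (frames (List.ofFn fun k => encodingIntBool.encode (v k))) := by
  rw [boolPair_eq]
  exact finVec_encode_eq encodingIntBool n v

/-- **On the code of `(B, d)`, the syntactic query `j < n` is the code of the `j`-th GMSS call
`((B⁽ʲ⁾, bⱼ), d)`.** [cite: GoldreichMicciancioSafraSeifert1999, §3] -/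
theorem query_encode (I : LatticeInstance) (d : ℚ) (j : Fin I.n) :
    query (gapSVPInstanceEncoding.encode (I, d)) j I.n = gapCVPInstanceEncoding.encode (gmssInstance I j, d) := by
  have hn : 0 < I.n := Fin.pos j
  have hle := jn_add_n_le I.n j
  set l₁ := (rowMajor I.n I.basis).take (j * I.n) with hl₁
  set l₂ := ((rowMajor I.n I.basis).drop (j * I.n)).take I.n with hl₂
  set l₃ := (rowMajor I.n I.basis).drop (j * I.n + I.n) with hl₃
  have hsplit : rowMajor I.n I.basis = l₁ ++ l₂ ++ l₃ := rowMajor_split I.n I.basis j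
  have hL : (rowMajor I.n I.basis).length = I.n * I.n := length_rowMajor _ _
  have h₁ : l₁.length = j * I.n := by rw [hl₁, List.length_take, hL]; exact min_eq_left (by omega)
  have h₂ : l₂.length = I.n := by rw [hl₂, List.length_take, List.length_drop, hL]; exact min_eq_left (by omega)
  have hd : dblEnts (j * I.n) I.n (frames (rowMajor I.n I.basis)) = frames (rowMajor I.n (doubleRow I j).basis) := by
    rw [rowMajor_doubleRow, ← hl₁, ← hl₂, ← hl₃, hsplit, ← h₁, ← h₂, dblEnts_frames]
  have hr : rowEnts (j * I.n) I.n (frames (rowMajor I.n I.basis)) =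
      frames (List.ofFn fun k : Fin I.n => encodingIntBool.encode (I.basis j k)) := by
    rw [← rowMajor_row, ← hl₂, hsplit, ← h₁, ← h₂, rowEnts_frames]
  rw [gapCVPInstanceEncoding_encode_gmssInstance, matrix_encode_eq, vec_encode_eq, query, gapSVP_encode_eq]
  simp only [boolUnpair_boolPair]
  rw [hd, hr]

end GMSS

/-- **The GMSS reduction as an oracle algorithm** (transcript model of `Oracle.lean`), with the
syntactic step `GMSS.gcore` applied to the input and the code of the transcript: in dimension `0`
(read off the binary header, saturating at `|x|`) output `true`; output YES as soon as some call
has been answered YES, NO after all `n` calls were answered otherwise, and else ask the next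
GMSS query `(B⁽ʲ⁾, bⱼ, d)` re-emitted from the parsed pieces of the input. On codes of `GapSVP`
instances this is the disjunctive scan over `gmssQueries` (`gmssAlg_step_encode`); on other
strings it is whatever the parser makes of them (no claim). [cite: MicciancioRegev2007, Lemma 5.22 (authors' version p. 27); GoldreichMicciancioSafraSeifert1999 Thm 1] -/
def gmssAlg : OracleAlg Bool where
  step x answers := GMSS.gcore x ((encodingList Bool).listBool.encode answers)

/-- The step of `gmssAlg` (definitional unfolding). [folklore] -/
theorem gmssAlg_step (x : List Bool) (answers : List (List Bool)) :
    gmssAlg.step x answers = GMSS.gcore x ((encodingList Bool).listBool.encode answers) := rfl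

/-- The step of `gmssAlg` on a well-formed input. [folklore] -/
theorem gmssAlg_step_encode (p : GapSVPInstance) (answers : List (List Bool)) :
    gmssAlg.step (gapSVPInstanceEncoding.encode p) answers =
      if p.1.n = 0 then Sum.inr true else scanStep (gmssQueries p) answers := by
  obtain ⟨I, d⟩ := p
  rw [gmssAlg_step, GMSS.gcore, GMSS.dimOf_encode, GMSS.thas_transcript, GMSS.tlen_transcript]
  by_cases h0 : I.n = 0
  · simp [h0]
  rw [if_neg h0, if_neg h0, scanStep]
  have hlen : (gmssQueries (I, d)).length = I.n := by simp [gmssQueries]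
  by_cases hmem : [true] ∈ answers
  · simp [hmem]
  rw [if_neg (by simpa using hmem), if_neg hmem]
  by_cases hlt : answers.length < I.n
  · rw [if_neg (by omega), dif_pos (by rw [hlen]; exact hlt)]
    refine congrArg Sum.inl ?_
    rw [GMSS.query_encode I d ⟨answers.length, hlt⟩]
    simp only [gmssQueries, List.getElem_ofFn]
  · rw [if_pos (by omega), dif_neg (by rw [hlen]; exact hlt)]

/-- NAMED FACT (TM2 level; nothing is asserted here — to be discharged by the sibling
`GapCVPPrimeMachine.lean`, next item, as `gmssAlg_isPolyTime_holds`; kept as a `def` per D-0014,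
users' hypotheses `(h : gmssAlg_isPolyTime)` are then fed the theorem). The step function of the GMSS oracle algorithm is polynomial-time
computable (`OracleAlg.IsPolyTime`: as a function of the `boolPair`-encoded pair of input and
transcript). This is the "polynomial time" clause of MR07 Lemma 5.22 / GMSS 1999 Thm. 1: the
machine decodes `x` and the transcript (the `listBool`/`boolPair` framing of `Encoding.lean`,
exactly as the syntactic step `GMSS.gcore` prescribes on every string), evaluates the binary
dimension header saturating at `|x|`, reads the transcript length `j` and tests whether some
answer equals `[true]`, and writes the `j`-th query — the code of `((B⁽ʲ⁾, bⱼ), d)`, a copy of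
the code of `B` in which every entry of row `j` is doubled (one extra low-order bit,
`GMSS.encodeNat_two_mul`), followed by a copy of row `j` and of `d`; all outputs have length
`≤ 31|x| + 22` on codes (`length_encode_gmssInstance_le`).
[cite: MicciancioRegev2007, Lemma 5.22 (authors' version p. 27); AroraBarak2009 §1.3] -/
def gmssAlg_isPolyTime : Prop :=
  gmssAlg.IsPolyTime encodingBoolBool

/-! ### Lemma 5.22 as a Cook reduction -/

/-- The round and query budget of the GMSS reduction: `31 X + 22`. [folklore] -/
def gmssBudget : Polynomial ℕ := 31 * Polynomial.X + 22

/-- Evaluation of the budget polynomial: `gmssBudget(k) = 31 k + 22`. [folklore] -/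
@[simp] theorem gmssBudget_eval (k : ℕ) : gmssBudget.eval k = 31 * k + 22 := by
  simp [gmssBudget]

/-- **Micciancio–Regev 2007, Lemma 5.22 / GMSS 1999 Thm. 1, as a Cook reduction of promise
problems** (Goldreich 2006 Def. 3), dimension-wise: for every factor `γ` and every set `T` of
dimensions, `GapSVP_γ` restricted to instances of dimension in `T` Cook-reduces — by the explicit
oracle algorithm `gmssAlg`, within `n + 1 ≤ 31|x| + 22` rounds and with queries of length
`≤ 31|x| + 22` — to `GapCVP′_γ` restricted to dimension in `T`, correct against every oracle
solving the latter (off-promise calls, which occur only on YES inputs, answered arbitrarily).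
Proved up to the machine-level fact `gmssAlg_isPolyTime` (polynomial running time of the step
function). YES inputs: some call `(B⁽ⁱ⁾, bᵢ, d)` is a YES instance of the same dimension
(`MicciancioRegev2007_lemma_5_22_restricted`), answered `[true]`, so the scan accepts
(`runAux_scan_of_exists_eq_true`); dimension `0`: accepted outright, correctly
(`mem_gapSVP_yes_of_n_eq_zero`). NO inputs: all calls are NO instances of the same dimension,
answered `[false]`, so the scan rejects after `n` calls (`runAux_scan_of_forall_eq_false`);
dimension `0` NO inputs exist only for `γ(0) < 0`, and then no oracle solves `GapCVP′_γ` in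
dimension `0` (`exists_mem_gapCVP'_yes_and_no_of_n_eq_zero`), so the requirement is vacuous.
[cite: MicciancioRegev2007, Lemma 5.22 (authors' version p. 27); Goldreich2006 §1.2 Def. 3] -/
theorem gapSVP_cookReducible_gapCVP' (hpoly : gmssAlg_isPolyTime) (γ : ℕ → ℝ) (T : Set ℕ) :
    (PromiseProblem.ofEncoding gapSVPInstanceEncoding
        {p | p ∈ GapSVP.yes γ ∧ p.1.n ∈ T} {p | p ∈ GapSVP.no γ ∧ p.1.n ∈ T}).CookReducible
      (PromiseProblem.ofEncoding gapCVPInstanceEncoding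
        {p | p ∈ GapCVP'.yes γ ∧ p.1.I.n ∈ T} {p | p ∈ GapCVP'.no γ ∧ p.1.I.n ∈ T}) := by
  refine ⟨gmssAlg, hpoly, gmssBudget, fun O hO x => ⟨fun hx => ?_, fun hx => ?_⟩⟩
  · -- YES inputs
    obtain ⟨⟨I, d⟩, ⟨hyes, hT⟩, rfl⟩ := hx
    have hbudget : I.n + 1 ≤ gmssBudget.eval (gapSVPInstanceEncoding.encode (I, d)).length := by
      rw [gmssBudget_eval]
      have := n_le_length_encode_gapSVP I d
      omega
    by_cases h0 : I.n = 0
    · -- dimension 0: accept at once, no query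
      obtain ⟨k, hk⟩ : ∃ k, gmssBudget.eval (gapSVPInstanceEncoding.encode (I, d)).length = k + 1 :=
        ⟨_, (Nat.succ_pred_eq_of_pos (by omega)).symm⟩
      refine ⟨?_, fun y hy => ?_⟩
      · change gmssAlg.runAux O _ _ [] = some true
        rw [hk, OracleAlg.runAux_succ, gmssAlg_step_encode, if_pos h0]
      · exfalso
        change y ∈ gmssAlg.queriesAux O _ _ [] at hy
        rw [hk] at hy
        unfold OracleAlg.queriesAux at hy
        rw [gmssAlg_step_encode, if_pos h0] at hy
        simp at hy
    · have hM : ∀ as, gmssAlg.step (gapSVPInstanceEncoding.encode (I, d)) as =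
          scanStep (gmssQueries (I, d)) as := fun as => by rw [gmssAlg_step_encode, if_neg h0]
      refine ⟨?_, fun y hy => ?_⟩
      · obtain ⟨i, hi⟩ := ((MicciancioRegev2007_lemma_5_22_restricted γ T I h0 d).1).1 ⟨hyes, hT⟩
        have hlen : (gmssQueries (I, d)).length = I.n := by simp [gmssQueries]
        have hilt : (i : ℕ) < (gmssQueries (I, d)).length := by rw [hlen]; exact i.isLt
        have hq : (gmssQueries (I, d))[(i : ℕ)]'hilt = gapCVPInstanceEncoding.encode (gmssInstance I i, d) := by
          simp [gmssQueries]
        have hOi : O ((gmssQueries (I, d))[(i : ℕ)]'hilt) = [true] := by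
          rw [hq]
          exact hO.2.1 _ ⟨_, hi, rfl⟩
        have hrun := runAux_scan_of_exists_eq_true hM hilt hOi I.n [] (by simp [hlen])
          (fun i hi => absurd hi (by simp))
        change gmssAlg.runAux O _ _ [] = some true
        exact OracleAlg.runAux_mono _ _ _ hbudget hrun
      · rw [gmssBudget_eval]
        exact length_le_of_mem_gmssQueries (mem_of_mem_queriesAux_scan hM _ _ y hy)
  · -- NO inputs
    obtain ⟨⟨I, d⟩, ⟨hno, hT⟩, rfl⟩ := hx
    by_cases h0 : I.n = 0
    · -- dimension 0: no oracle solves the target problem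
      exfalso
      obtain ⟨hy, hn⟩ := exists_mem_gapCVP'_yes_and_no_of_n_eq_zero (γ := γ) h0 hno
      have h1 := hO.2.1 (gapCVPInstanceEncoding.encode ((⟨I, 0⟩ : CVPInstance), d)) ⟨_, ⟨hy, hT⟩, rfl⟩
      have h2 := hO.2.2 (gapCVPInstanceEncoding.encode ((⟨I, 0⟩ : CVPInstance), d)) ⟨_, ⟨hn, hT⟩, rfl⟩
      rw [h1] at h2
      exact absurd h2 (by simp)
    · have hall := (MicciancioRegev2007_lemma_5_22_restricted γ T I h0 d).2 ⟨hno, hT⟩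
      have hOq : ∀ q ∈ gmssQueries (I, d), O q = [false] := by
        intro q hq
        simp only [gmssQueries, List.mem_ofFn] at hq
        obtain ⟨i, rfl⟩ := hq
        exact hO.2.2 _ ⟨_, hall i, rfl⟩
      have hM : ∀ as, gmssAlg.step (gapSVPInstanceEncoding.encode (I, d)) as =
          scanStep (gmssQueries (I, d)) as := fun as => by rw [gmssAlg_step_encode, if_neg h0]
      have hbudget : I.n + 1 ≤ gmssBudget.eval (gapSVPInstanceEncoding.encode (I, d)).length := by
        rw [gmssBudget_eval]
        have := n_le_length_encode_gapSVP I d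
        omega
      refine ⟨?_, fun y hy => ?_⟩
      · have hrun := runAux_scan_of_forall_eq_false (M := gmssAlg) (O := O) hM hOq I.n 0
          (by simp [gmssQueries])
        change gmssAlg.runAux O _ _ [] = some false
        exact OracleAlg.runAux_mono _ _ _ hbudget hrun
      · rw [gmssBudget_eval]
        exact length_le_of_mem_gmssQueries (mem_of_mem_queriesAux_scan hM _ _ y hy)

end Literature.Algebra.EuclideanLattices

end
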